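import Literature.Analysis.FluidPDE.AgeDecouplingWindows
import HarnessLib

/-!
# The age-decoupling inequality for Cesàro means (real-variable core)

Analysis/FluidPDE proof-support file (everything proved). The real-variable heart of the
*age-decoupling* estimate for a steadily sourced, viscously damped scalar (a scalar `θ` solving
`∂ₜθ + v·∇θ = νΔθ + h` with bounded variance): its mean dissipation is controlled by the
variance ceiling divided by the age window `S`, plus terms carrying the window-`S` dissipation of
RELEASES of the source profile. All the PDE content (energy inequality of the sourced scalar,
pairing identities between the scalar and the releases, Duhamel superposition) is abstracted into
two scalar inequalities between five real functions of time,

* `q` — the dissipation rate (`ν‖∇θ(t)‖²`), `p` — the power input (`(h, θ(t))`),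
  `e` — the variance (`‖θ(t)‖²`), `w` — the square root of the window dissipation of the release
  started at time `s` (`w(s)² = D(s;S) = ν∫ₛ^{s+S}‖∇ϑ_s‖²`), `b` — a slack (discretisation
  errors; `b = 0` in the continuum argument):
* (H1) energy inequality `∫₀ᵀ q ≤ C₀ + ∫₀ᵀ p` for all large `T`;
* (H2) window inequality, for a.e. `t > S`:
  `∫_{t-S}^t p ≤ e(t)/2 + 2 (∫_{t-S}^t q)^{1/2} (∫_{t-S}^t w) + (∫_{t-S}^t w)² + b(t)`;
* (H3) `p² ≤ c·e` (Cauchy–Schwarz `(h,θ)² ≤ ‖h‖²‖θ‖²`), making the windows of `p` Cesàro-null;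

and the conclusion is the bound on the `limsup` Cesàro mean `⟨q⟩ = longTimeAvgSup q`

  `⟨q⟩ ≤ ( (S⟨w²⟩)^{1/2} + (⟨e⟩/(2S) + ⟨b⟩/S + 2S⟨w²⟩)^{1/2} )²`   (`longTimeAvgSup_le_of_window`),

which for quiet releases (`⟨w²⟩ = 0`) and no slack reads `⟨q⟩ ≤ ⟨e⟩/(2S)`. The sequence form
used downstream (`tendsto_zero_of_forall_limsup_le_div`): if for every `S > 0` the `limsup` over a
family is `≤ E/(2S)`, the family tends to `0`.

Proof: integrate (H2) over `t ∈ (S, T]`; the left side is `S∫₀ᵀ p` up to a window of `|p|` of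
length `S` at the end (Cesàro-null by (H3)) and a constant; the right side is bounded through
Fubini-free monotonicity (`∫_S^T ∫_{t-S}^t f ≤ S ∫₀ᵀ f` for `f ≥ 0`, proved via primitives) and
Cauchy–Schwarz in time; (H1) closes the loop and the resulting scalar inequality
`x ≤ a + 2(Sxd)^{1/2} + Sd` is absorbed (`le_sq_of_le_add_two_mul_sqrt`). Everything is stated
for Mathlib's real `limsup` (junk `0` for unbounded families), whence the eventual-boundedness
hypotheses on the Cesàro means of `e`, `w²`, `b`.

References: the estimate is folklore bookkeeping (Duhamel superposition + Cauchy–Schwarz) in the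
spirit of the energy-budget method of C. R. Doering, C. Foias, J. Fluid Mech. 467 (2002) §2–3 and
of the passive-scalar balance of T. D. Drivas, T. M. Elgindi, G. Iyer, I.-J. Jeong, ARMA 243
(2022), (1.2)–(1.3); no single printed source.
-/

noncomputable section

open _root_.MeasureTheory _root_.Set _root_.Filter
open scoped _root_.Topology

namespace Literature.Analysis.FluidPDE

namespace AgeDecoupling

/-! ## The inequality at a finite horizon -/

section Main

variable {p e q w b : ℝ → ℝ} {S C₀ c : ℝ}

/-- Square integrability of `p` on `(0,T]` from (H3) `p² ≤ c e`. [folklore] -/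
theorem integrableOn_sq_of_sq_le (hp : ∀ T, IntegrableOn p (Ioc 0 T))
    (he : ∀ T, IntegrableOn e (Ioc 0 T))
    (hpe : ∀ᵐ t ∂(volume.restrict (Ioi 0)), p t ^ 2 ≤ c * e t) (T : ℝ) :
    IntegrableOn (fun s => p s ^ 2) (Ioc 0 T) := by
  refine Integrable.mono' ((he T).const_mul c) ((hp T).aestronglyMeasurable.pow 2) ?_
  filter_upwards [ae_restrict_of_ae_restrict_of_subset Ioc_subset_Ioi_self hpe] with t ht
  rw [Real.norm_eq_abs, abs_of_nonneg (sq_nonneg _)]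
  exact ht

/-- The end window of `|p|` is controlled by the variance budget:
`∫_{T-S}^T |p| ≤ (S c ∫₀ᵀ e)^{1/2}` (`0 ≤ S ≤ T`, (H3) `p² ≤ c e`). [folklore] -/
theorem integral_abs_window_le (hp : ∀ T, IntegrableOn p (Ioc 0 T))
    (he : ∀ T, IntegrableOn e (Ioc 0 T))
    (hpe : ∀ᵐ t ∂(volume.restrict (Ioi 0)), p t ^ 2 ≤ c * e t) {S T : ℝ} (hS : 0 ≤ S)
    (hT : S ≤ T) :
    ∫ s in (T - S)..T, |p s| ≤ Real.sqrt (S * c * ∫ t in (0 : ℝ)..T, e t) := by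
  have hp2 := integrableOn_sq_of_sq_le hp he hpe
  have habs : ∀ T, IntegrableOn (fun s => |p s|) (Ioc 0 T) := fun T => (hp T).abs
  have habs2 : ∀ T, IntegrableOn (fun s => |p s| ^ 2) (Ioc 0 T) := fun T => by
    simpa only [sq_abs] using hp2 T
  have h1 : (∫ s in (T - S)..T, |p s|) ^ 2 ≤ S * ∫ s in (T - S)..T, |p s| ^ 2 :=
    sq_window_le habs habs2 (fun t => abs_nonneg _) hS hT
  have h2 : ∫ s in (T - S)..T, |p s| ^ 2 ≤ ∫ s in (0 : ℝ)..T, |p s| ^ 2 :=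
    intervalIntegral.integral_mono_interval (by linarith) (by linarith) le_rfl
      (ae_of_all _ fun _ => sq_nonneg _)
      (intervalIntegrable_of_forall_integrableOn habs2 le_rfl (hS.trans hT))
  have h3 : ∫ s in (0 : ℝ)..T, |p s| ^ 2 ≤ ∫ s in (0 : ℝ)..T, c * e s := by
    refine intervalIntegral.integral_mono_ae_restrict (hS.trans hT)
      (intervalIntegrable_of_forall_integrableOn habs2 le_rfl (hS.trans hT))
      ((intervalIntegrable_of_forall_integrableOn he le_rfl (hS.trans hT)).const_mul c) ?_
    rw [← Measure.restrict_congr_set Ioc_ae_eq_Icc]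
    filter_upwards [ae_restrict_of_ae_restrict_of_subset Ioc_subset_Ioi_self hpe] with t ht
    rwa [sq_abs]
  rw [intervalIntegral.integral_const_mul] at h3
  have h0 : 0 ≤ ∫ s in (T - S)..T, |p s| :=
    intervalIntegral.integral_nonneg (by linarith) fun _ _ => abs_nonneg _
  calc ∫ s in (T - S)..T, |p s| = Real.sqrt ((∫ s in (T - S)..T, |p s|) ^ 2) := (Real.sqrt_sq h0).symm
    _ ≤ Real.sqrt (S * c * ∫ t in (0 : ℝ)..T, e t) := Real.sqrt_le_sqrt (by nlinarith)

/-- **The age-decoupling inequality at a finite horizon.** Under (H2) (a.e. `t > S`) and (H1) at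
the horizon `T ≥ S > 0`, with `e, q, w, b ≥ 0` integrable on every `(0, T']`:
`S∫₀ᵀ q ≤ S C₀ + ∫₀^S P + S∫_{T-S}^T |p| + ½∫₀ᵀ e + 2 (S∫₀ᵀ q)^{1/2} (S²∫₀ᵀ w²)^{1/2} + S²∫₀ᵀ w² + ∫₀ᵀ b`
(`P(t) = ∫₀ᵗ p`). [folklore] -/
theorem mul_integral_le_of_window (hS : 0 < S) (hp : ∀ T, IntegrableOn p (Ioc 0 T))
    (he : ∀ T, IntegrableOn e (Ioc 0 T)) (hq : ∀ T, IntegrableOn q (Ioc 0 T))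
    (hw : ∀ T, IntegrableOn w (Ioc 0 T)) (hw2 : ∀ T, IntegrableOn (fun s => w s ^ 2) (Ioc 0 T))
    (hb : ∀ T, IntegrableOn b (Ioc 0 T)) (he0 : ∀ t, 0 ≤ e t) (hq0 : ∀ t, 0 ≤ q t)
    (hw0 : ∀ t, 0 ≤ w t) (hb0 : ∀ t, 0 ≤ b t)
    (h2 : ∀ᵐ t ∂(volume.restrict (Ioi S)),
      ∫ s in (t - S)..t, p s ≤ e t / 2 +
        2 * Real.sqrt (∫ s in (t - S)..t, q s) * (∫ s in (t - S)..t, w s) +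
        (∫ s in (t - S)..t, w s) ^ 2 + b t)
    {T : ℝ} (hT : S ≤ T) (h1 : ∫ t in (0 : ℝ)..T, q t ≤ C₀ + ∫ t in (0 : ℝ)..T, p t) :
    S * ∫ t in (0 : ℝ)..T, q t ≤
      S * C₀ + (∫ t in (0 : ℝ)..S, ∫ s in (0 : ℝ)..t, p s) + S * (∫ s in (T - S)..T, |p s|) +
        (1 / 2) * (∫ t in (0 : ℝ)..T, e t) +
        2 * Real.sqrt (S * ∫ t in (0 : ℝ)..T, q t) * Real.sqrt (S ^ 2 * ∫ t in (0 : ℝ)..T, w t ^ 2) +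
        S ^ 2 * (∫ t in (0 : ℝ)..T, w t ^ 2) + ∫ t in (0 : ℝ)..T, b t := by
  set Wq : ℝ → ℝ := fun t => ∫ s in (t - S)..t, q s with hWq
  set Ww : ℝ → ℝ := fun t => ∫ s in (t - S)..t, w s with hWw
  set Wp : ℝ → ℝ := fun t => ∫ s in (t - S)..t, p s with hWp
  set Ww2 : ℝ → ℝ := fun t => ∫ s in (t - S)..t, w s ^ 2 with hWw2
  have hS0 := hS.le
  have hT0 : 0 ≤ T := hS0.trans hT
  -- nonnegativity of the windows on `[S, T]`
  have hWq0 : ∀ t ∈ Icc S T, 0 ≤ Wq t := fun t ht =>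
    intervalIntegral.integral_nonneg (by linarith [ht.1]) fun s _ => hq0 s
  have hWw0 : ∀ t ∈ Icc S T, 0 ≤ Ww t := fun t ht =>
    intervalIntegral.integral_nonneg (by linarith [ht.1]) fun s _ => hw0 s
  -- continuity on `[S, T]`
  have hcWq : ContinuousOn Wq (Icc S T) := continuousOn_window hq hS0 T
  have hcWw : ContinuousOn Ww (Icc S T) := continuousOn_window hw hS0 T
  have hcG : ContinuousOn (fun t => 2 * Real.sqrt (Wq t) * Ww t) (Icc S T) :=
    (continuousOn_const.mul hcWq.sqrt).mul hcWw
  have hcW2 : ContinuousOn (fun t => Ww t ^ 2) (Icc S T) := hcWw.pow 2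
  -- interval integrability on `[S, T]`
  have iWp : IntervalIntegrable Wp volume S T := intervalIntegrable_window hp hS0 hT
  have iWq : IntervalIntegrable Wq volume S T := intervalIntegrable_window hq hS0 hT
  have iWw2 : IntervalIntegrable Ww2 volume S T := intervalIntegrable_window hw2 hS0 hT
  have iG : IntervalIntegrable (fun t => 2 * Real.sqrt (Wq t) * Ww t) volume S T :=
    ContinuousOn.intervalIntegrable (by rwa [uIcc_of_le hT])
  have iW2 : IntervalIntegrable (fun t => Ww t ^ 2) volume S T :=
    ContinuousOn.intervalIntegrable (by rwa [uIcc_of_le hT])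
  have ie : IntervalIntegrable (fun t => e t / 2) volume S T :=
    (intervalIntegrable_of_forall_integrableOn he hS0 hT0).div_const 2
  have ib : IntervalIntegrable b volume S T := intervalIntegrable_of_forall_integrableOn hb hS0 hT0
  -- Step 1: integrate (H2) over `[S, T]`
  have step1 : ∫ t in S..T, Wp t ≤
      ∫ t in S..T, (e t / 2 + 2 * Real.sqrt (Wq t) * Ww t + Ww t ^ 2 + b t) := by
    refine intervalIntegral.integral_mono_ae_restrict hT iWp (((ie.add iG).add iW2).add ib) ?_
    have h2' : ∀ᵐ t ∂(volume.restrict (Ioc S T)), Wp t ≤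
        e t / 2 + 2 * Real.sqrt (Wq t) * Ww t + Ww t ^ 2 + b t :=
      ae_restrict_of_ae_restrict_of_subset Ioc_subset_Ioi_self h2
    rw [Measure.restrict_congr_set Ioc_ae_eq_Icc] at h2'
    exact h2'
  -- Step 2: split the right-hand side
  have step2 : ∫ t in S..T, (e t / 2 + 2 * Real.sqrt (Wq t) * Ww t + Ww t ^ 2 + b t) =
      (∫ t in S..T, e t / 2) + (∫ t in S..T, 2 * Real.sqrt (Wq t) * Ww t) +
        (∫ t in S..T, Ww t ^ 2) + ∫ t in S..T, b t := by
    rw [intervalIntegral.integral_add ((ie.add iG).add iW2) ib,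
      intervalIntegral.integral_add (ie.add iG) iW2, intervalIntegral.integral_add ie iG]
  -- bounds on the four pieces
  have be : ∫ t in S..T, e t / 2 ≤ (1 / 2) * ∫ t in (0 : ℝ)..T, e t := by
    rw [intervalIntegral.integral_div]
    have : ∫ t in S..T, e t ≤ ∫ t in (0 : ℝ)..T, e t :=
      intervalIntegral.integral_mono_interval hS0 hT le_rfl (ae_of_all _ fun t => he0 t)
        (intervalIntegrable_of_forall_integrableOn he le_rfl hT0)
    linarith
  have bb : ∫ t in S..T, b t ≤ ∫ t in (0 : ℝ)..T, b t :=
    intervalIntegral.integral_mono_interval hS0 hT le_rfl (ae_of_all _ fun t => hb0 t)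
      (intervalIntegrable_of_forall_integrableOn hb le_rfl hT0)
  have bW2pt : ∀ t ∈ Icc S T, Ww t ^ 2 ≤ S * Ww2 t := fun t ht =>
    sq_window_le hw hw2 hw0 hS0 ht.1
  have bW2 : ∫ t in S..T, Ww t ^ 2 ≤ S ^ 2 * ∫ t in (0 : ℝ)..T, w t ^ 2 := by
    calc ∫ t in S..T, Ww t ^ 2 ≤ ∫ t in S..T, S * Ww2 t :=
          intervalIntegral.integral_mono_on hT iW2 (iWw2.const_mul S) bW2pt
      _ = S * ∫ t in S..T, Ww2 t := intervalIntegral.integral_const_mul _ _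
      _ ≤ S * (S * ∫ t in (0 : ℝ)..T, w t ^ 2) :=
          mul_le_mul_of_nonneg_left (integral_window_le hw2 (fun t => sq_nonneg _) hS0 hT) hS0
      _ = S ^ 2 * ∫ t in (0 : ℝ)..T, w t ^ 2 := by ring
  have bWq : ∫ t in S..T, Wq t ≤ S * ∫ t in (0 : ℝ)..T, q t := integral_window_le hq hq0 hS0 hT
  -- Cauchy–Schwarz in time for the cross term
  have hcs : ∫ t in S..T, Real.sqrt (Wq t) * Ww t ≤
      Real.sqrt ((∫ t in S..T, Wq t) * ∫ t in S..T, Ww t ^ 2) := by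
    rw [intervalIntegral.integral_of_le hT, intervalIntegral.integral_of_le hT,
      intervalIntegral.integral_of_le hT]
    refine integral_le_sqrt_integral_mul_integral ?_ ?_ ?_ ?_ ?_ iWq.1 iW2.1
    · filter_upwards [ae_restrict_mem measurableSet_Ioc] with t ht
      exact mul_nonneg (Real.sqrt_nonneg _) (hWw0 t (Ioc_subset_Icc_self ht))
    · filter_upwards [ae_restrict_mem measurableSet_Ioc] with t ht
      exact hWq0 t (Ioc_subset_Icc_self ht)
    · exact ae_of_all _ fun t => sq_nonneg _
    · filter_upwards [ae_restrict_mem measurableSet_Ioc] with t ht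
      rw [mul_pow, Real.sq_sqrt (hWq0 t (Ioc_subset_Icc_self ht))]
    · exact ((hcWq.sqrt.mul hcWw).mono Ioc_subset_Icc_self).aestronglyMeasurable measurableSet_Ioc
  have bG : ∫ t in S..T, 2 * Real.sqrt (Wq t) * Ww t ≤
      2 * Real.sqrt (S * ∫ t in (0 : ℝ)..T, q t) * Real.sqrt (S ^ 2 * ∫ t in (0 : ℝ)..T, w t ^ 2) := by
    have e1 : ∫ t in S..T, 2 * Real.sqrt (Wq t) * Ww t = 2 * ∫ t in S..T, Real.sqrt (Wq t) * Ww t := by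
      rw [← intervalIntegral.integral_const_mul]
      refine intervalIntegral.integral_congr fun t _ => ?_
      ring
    rw [e1, mul_assoc]
    refine mul_le_mul_of_nonneg_left (hcs.trans ?_) zero_le_two
    have hq0' : 0 ≤ ∫ t in S..T, Wq t := intervalIntegral.integral_nonneg hT hWq0
    rw [← Real.sqrt_mul (hq0'.trans bWq)]
    refine Real.sqrt_le_sqrt ?_
    have hw0' : 0 ≤ ∫ t in S..T, Ww t ^ 2 := intervalIntegral.integral_nonneg hT fun t _ => sq_nonneg _
    exact mul_le_mul bWq bW2 hw0' (hq0'.trans bWq)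
  -- Step 3: the left-hand side
  have step3 := sub_le_integral_window hp hS0 hT
  have h1' : S * ∫ t in (0 : ℝ)..T, q t ≤ S * C₀ + S * ∫ t in (0 : ℝ)..T, p t := by
    have := mul_le_mul_of_nonneg_left h1 hS0
    linarith
  linarith [step1, step2, be, bb, bW2, bG, step3, h1']

end Main


/-! ## The inequality for `limsup` Cesàro means -/

section Limsup

variable {p e q w b : ℝ → ℝ} {S C₀ c : ℝ}

/-- **The age-decoupling inequality (Cesàro form).** Let `S > 0` and let `p, e, q, w, b` be real
functions integrable on every `(0,T]` with `e, q, w, b ≥ 0`, satisfying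
(H1) `∫₀ᵀ q ≤ C₀ + ∫₀ᵀ p` for all large `T`;
(H2) for a.e. `t > S`,
`∫_{t-S}^t p ≤ e(t)/2 + 2(∫_{t-S}^t q)^{1/2}(∫_{t-S}^t w) + (∫_{t-S}^t w)² + b(t)`;
(H3) `p² ≤ c e` a.e. on `(0, ∞)`;
and whose Cesàro means of `e`, `w²`, `b` are eventually bounded above. Then, with
`⟨·⟩ = longTimeAvgSup` (the `limsup` of `T⁻¹∫₀ᵀ`),
`⟨q⟩ ≤ ((S⟨w²⟩)^{1/2} + (⟨e⟩/(2S) + ⟨b⟩/S + 2S⟨w²⟩)^{1/2})²`.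
For a steadily sourced scalar (`q = ν‖∇θ‖²`, `p = (h,θ)`, `e = ‖θ‖²`, `w(s)² =` window-`S`
dissipation of the release of `h` at time `s`) this is the statement that the mean dissipation
is at most `⟨‖θ‖²⟩/(2S)` plus terms that vanish with the mean window dissipation of the releases.
[folklore] -/
theorem longTimeAvgSup_le_of_window (hS : 0 < S) (hp : ∀ T, IntegrableOn p (Ioc 0 T))
    (he : ∀ T, IntegrableOn e (Ioc 0 T)) (hq : ∀ T, IntegrableOn q (Ioc 0 T))
    (hw : ∀ T, IntegrableOn w (Ioc 0 T)) (hw2 : ∀ T, IntegrableOn (fun s => w s ^ 2) (Ioc 0 T))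
    (hb : ∀ T, IntegrableOn b (Ioc 0 T)) (he0 : ∀ t, 0 ≤ e t) (hq0 : ∀ t, 0 ≤ q t)
    (hw0 : ∀ t, 0 ≤ w t) (hb0 : ∀ t, 0 ≤ b t) (hc : 0 ≤ c)
    (hpe : ∀ᵐ t ∂(volume.restrict (Ioi 0)), p t ^ 2 ≤ c * e t)
    (h1 : ∀ᶠ T in atTop, ∫ t in (0 : ℝ)..T, q t ≤ C₀ + ∫ t in (0 : ℝ)..T, p t)
    (h2 : ∀ᵐ t ∂(volume.restrict (Ioi S)),
      ∫ s in (t - S)..t, p s ≤ e t / 2 +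
        2 * Real.sqrt (∫ s in (t - S)..t, q s) * (∫ s in (t - S)..t, w s) +
        (∫ s in (t - S)..t, w s) ^ 2 + b t)
    (he_bdd : IsBoundedUnder (· ≤ ·) atTop (timeMean e))
    (hw_bdd : IsBoundedUnder (· ≤ ·) atTop (timeMean fun s => w s ^ 2))
    (hb_bdd : IsBoundedUnder (· ≤ ·) atTop (timeMean b)) :
    longTimeAvgSup q ≤
      (Real.sqrt (S * longTimeAvgSup (fun s => w s ^ 2)) +
        Real.sqrt (longTimeAvgSup e / (2 * S) + longTimeAvgSup b / S +
          2 * S * longTimeAvgSup (fun s => w s ^ 2))) ^ 2 := by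
  have hS0 := hS.le
  set R := longTimeAvgSup e with hR
  set D := longTimeAvgSup (fun s => w s ^ 2) with hD
  set β := longTimeAvgSup b with hβ
  set C₁ : ℝ := ∫ t in (0 : ℝ)..S, ∫ s in (0 : ℝ)..t, p s with hC₁
  set π : ℝ → ℝ := fun T => T⁻¹ * ∫ s in (T - S)..T, |p s| with hπ
  set a : ℝ → ℝ := fun T => timeMean e T / (2 * S) + timeMean b T / S +
    (π T + (C₀ + C₁ / S) * T⁻¹) with ha
  -- the bound `M` on the Cesàro means of `e`
  obtain ⟨M, hM⟩ := he_bdd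
  rw [eventually_map] at hM
  -- the finite-horizon inequality divided by `S T`
  have hmain : ∀ᶠ T in atTop, timeMean q T ≤ a T +
      2 * Real.sqrt (S * timeMean q T * timeMean (fun s => w s ^ 2) T) +
      S * timeMean (fun s => w s ^ 2) T := by
    filter_upwards [h1, eventually_ge_atTop S, eventually_gt_atTop (0 : ℝ)] with T h1T hST hT0
    have hfin := mul_integral_le_of_window hS hp he hq hw hw2 hb he0 hq0 hw0 hb0 h2 hST h1T
    have hTi : 0 < T⁻¹ := inv_pos.mpr hT0
    -- rewrite everything through Cesàro means
    have eq_q : ∫ t in (0 : ℝ)..T, q t = T * timeMean q T := by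
      rw [timeMean, ← mul_assoc, mul_inv_cancel₀ hT0.ne', one_mul]
    have eq_e : ∫ t in (0 : ℝ)..T, e t = T * timeMean e T := by
      rw [timeMean, ← mul_assoc, mul_inv_cancel₀ hT0.ne', one_mul]
    have eq_w : ∫ t in (0 : ℝ)..T, w t ^ 2 = T * timeMean (fun s => w s ^ 2) T := by
      rw [timeMean, ← mul_assoc, mul_inv_cancel₀ hT0.ne', one_mul]
    have eq_b : ∫ t in (0 : ℝ)..T, b t = T * timeMean b T := by
      rw [timeMean, ← mul_assoc, mul_inv_cancel₀ hT0.ne', one_mul]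
    have eq_p : ∫ s in (T - S)..T, |p s| = T * π T := by
      rw [hπ]; simp only; rw [← mul_assoc, mul_inv_cancel₀ hT0.ne', one_mul]
    set x := timeMean q T with hx
    set dd := timeMean (fun s => w s ^ 2) T with hdd
    rw [eq_q, eq_e, eq_w, eq_b, eq_p] at hfin
    have hx0 : 0 ≤ x := timeMean_nonneg hq0 hT0.le
    have hdd0 : 0 ≤ dd := timeMean_nonneg (fun s => sq_nonneg _) hT0.le
    -- the square roots: `√(S T x) √(S² T dd) = S T √(S x dd)`
    have hsqrt : 2 * Real.sqrt (S * (T * x)) * Real.sqrt (S ^ 2 * (T * dd)) =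
        2 * (S * T * Real.sqrt (S * x * dd)) := by
      rw [mul_assoc, ← Real.sqrt_mul (mul_nonneg hS0 (mul_nonneg hT0.le hx0))]
      congr 1
      have : S * (T * x) * (S ^ 2 * (T * dd)) = (S * T) ^ 2 * (S * x * dd) := by ring
      rw [this, Real.sqrt_mul (sq_nonneg _), Real.sqrt_sq (mul_pos hS hT0).le]
    rw [hsqrt] at hfin
    -- divide by `S T`
    have hST : 0 < S * T := mul_pos hS hT0
    rw [ha]
    simp only
    have key : S * T * x ≤ S * T * (timeMean e T / (2 * S) + timeMean b T / S +
        (π T + (C₀ + C₁ / S) * T⁻¹) + 2 * Real.sqrt (S * x * dd) + S * dd) := by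
      have expand : S * T * (timeMean e T / (2 * S) + timeMean b T / S +
          (π T + (C₀ + C₁ / S) * T⁻¹) + 2 * Real.sqrt (S * x * dd) + S * dd) =
          S * C₀ + C₁ + S * (T * π T) + 1 / 2 * (T * timeMean e T) +
            2 * (S * T * Real.sqrt (S * x * dd)) + S ^ 2 * (T * dd) + T * timeMean b T := by
        field_simp
        ring
      rw [expand]
      linarith [hfin]
    exact le_of_mul_le_mul_left key hST
  -- the vanishing terms: `π T + (C₀ + C₁/S)/T → 0`
  have hπ_le : ∀ᶠ T in atTop, π T ≤ Real.sqrt (S * c * max M 0 * T⁻¹) := by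
    filter_upwards [hM, eventually_ge_atTop S, eventually_gt_atTop (0 : ℝ)] with T hMT hST hT0
    have h1 := integral_abs_window_le hp he hpe hS0 hST
    have eq_e : ∫ t in (0 : ℝ)..T, e t = T * timeMean e T := by
      rw [timeMean, ← mul_assoc, mul_inv_cancel₀ hT0.ne', one_mul]
    rw [eq_e] at h1
    have h2 : S * c * (T * timeMean e T) ≤ S * c * (T * max M 0) :=
      mul_le_mul_of_nonneg_left (mul_le_mul_of_nonneg_left (hMT.trans (le_max_left _ _)) hT0.le)
        (mul_nonneg hS0 hc)
    have h3 : π T ≤ T⁻¹ * Real.sqrt (S * c * (T * max M 0)) := by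
      rw [hπ]
      exact mul_le_mul_of_nonneg_left (h1.trans (Real.sqrt_le_sqrt h2)) (inv_nonneg.mpr hT0.le)
    refine h3.trans (le_of_eq ?_)
    have hT' : T⁻¹ = Real.sqrt (T⁻¹ ^ 2) := (Real.sqrt_sq (inv_nonneg.mpr hT0.le)).symm
    conv_lhs => rw [hT', ← Real.sqrt_mul (sq_nonneg _)]
    congr 1
    field_simp
  have hvan : Tendsto (fun T : ℝ => Real.sqrt (S * c * max M 0 * T⁻¹) + (C₀ + C₁ / S) * T⁻¹)
      atTop (𝓝 0) := by
    have h0 : Tendsto (fun T : ℝ => T⁻¹) atTop (𝓝 0) := tendsto_inv_atTop_zero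
    have h1 : Tendsto (fun T : ℝ => Real.sqrt (S * c * max M 0 * T⁻¹)) atTop (𝓝 0) := by
      have := (h0.const_mul (S * c * max M 0)).sqrt
      simpa using this
    have h2 : Tendsto (fun T : ℝ => (C₀ + C₁ / S) * T⁻¹) atTop (𝓝 0) := by
      simpa using h0.const_mul (C₀ + C₁ / S)
    simpa using h1.add h2
  -- assemble through the absorption lemma
  have hR_ev : ∀ ε, 0 < ε → ∀ᶠ T in atTop, timeMean e T ≤ R + ε := fun ε hε =>
    (eventually_lt_of_limsup_lt (show longTimeAvgSup e < R + ε by rw [← hR]; linarith)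
      ⟨M, eventually_map.mpr hM⟩).mono fun T hT => hT.le
  have hβ_ev : ∀ ε, 0 < ε → ∀ᶠ T in atTop, timeMean b T ≤ β + ε := fun ε hε =>
    (eventually_lt_of_limsup_lt (show longTimeAvgSup b < β + ε by rw [← hβ]; linarith)
      hb_bdd).mono fun T hT => hT.le
  have hD_ev : ∀ ε, 0 < ε → ∀ᶠ T in atTop, timeMean (fun s => w s ^ 2) T ≤ D + ε := fun ε hε =>
    (eventually_lt_of_limsup_lt (show longTimeAvgSup (fun s => w s ^ 2) < D + ε by
      rw [← hD]; linarith) hw_bdd).mono fun T hT => hT.le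
  have ha_ev : ∀ ε, 0 < ε → ∀ᶠ T in atTop, a T ≤ (R / (2 * S) + β / S) + ε := by
    intro ε hε
    have hε' : 0 < ε * S / 2 := by positivity
    filter_upwards [hR_ev _ hε', hβ_ev _ hε', hπ_le,
      (hvan.eventually (gt_mem_nhds (show ε / 4 > 0 by positivity)) :)] with T hRT hβT hπT hvT
    rw [ha]
    simp only
    have e1 : timeMean e T / (2 * S) ≤ R / (2 * S) + ε / 4 := by
      rw [div_le_iff₀ (by positivity)]
      have : (R / (2 * S) + ε / 4) * (2 * S) = R + ε * S / 2 := by field_simp; ring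
      linarith
    have e2 : timeMean b T / S ≤ β / S + ε / 2 := by
      rw [div_le_iff₀ hS]
      have : (β / S + ε / 2) * S = β + ε * S / 2 := by field_simp
      linarith
    linarith
  show limsup (timeMean q) atTop ≤ _
  have := limsup_le_sq_of_eventually_le (l := atTop) (x := timeMean q) (a := a)
    (d := timeMean fun s => w s ^ 2) (A := R / (2 * S) + β / S) (D := D) hS0
    ((eventually_ge_atTop (0 : ℝ)).mono fun T hT => timeMean_nonneg hq0 hT)
    ((eventually_ge_atTop (0 : ℝ)).mono fun T hT => timeMean_nonneg (fun s => sq_nonneg _) hT)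
    ha_ev hD_ev hmain
  simpa only [add_assoc] using this

end Limsup

end AgeDecoupling

end Literature.Analysis.FluidPDE

end
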